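import Mathlib
import Summits.ValiantsHypothesis.ValiantsHypothesis.Theorems.RigidityForcesSymmetryRankRigidMinimalReprLaplaceFiveSeparatedCaptureLinesK1
import Summits.ValiantsHypothesis.ValiantsHypothesis.Theorems.RigidityForcesSymmetryRankRigidMinimalReprLaplaceFiveSeparatedCaptureEqualLinesMem

/-!
# ValiantsHypothesis / RigidityForcesSymmetry — crux `LaplaceOptimalFive` (stmt-ValiantsHypothesis-24813), young-shadow K1:
# **K1 ON `K₃ ⊔ K₂` FOR «TWO TRIANGLE CUTS WITH ≤ 1 DIRECTION, THE THIRD WITH ≤ 3»** and **FOR A PROLONGATION-FREE JOINT SHORT SPAN**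

K1 consumers (local bridge ✓ `sideSym_K32canon_of_captureAt`, shape of ✓ `sideSym_K32canon_two_lines / _triangle`) of the two
(SC) cells landed by val-lit-p6 g19:
* ✓ `captureIneqSym_of_two_lines_le_three` (profiles `(1,1,r)`, `r ≤ 3`) ⇒ ★★ `sideSym_K32canon_two_lines_three`: short spans of
  dimension `≤ 1, ≤ 1, ≤ 3` on the cuts `{0,1}, {0,2}, {1,2}` ⇒ Laplace weight `≥ 5! = 120` (+ the placements with the wide cut at
  `{0,1}` / `{0,2}`, ✓ `contractZ_mem_L3_swap13/23`), superseding ✓ `sideSym_K32canon_two_lines(_wide01/_wide02)` (`≤ 2`);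
* ✓ `captureIneqSym_of_prolong_eq_bot` ⇒ ★★ `sideSym_K32canon_of_prolong_eq_bot`: if the joint span of the three triangle short
  spans has no prolongation (no nonzero fully symmetric 3-tensor has all its slices in it), weight `≥ 120` — any dimensions.

Honest framing.  SUB-CASES of K1 on `K₃ ⊔ K₂`; K1 on `K₃ ⊔ K₂` in general, `CaptureIneqSym`, S2′, `LaplaceOptimalFive`
(OPEN · CONTESTED 72/120), `RankRigidMinimalRepr`, `VP ≠ VNP` are NOT proved.  No definitions, no `sorry`.
-/

set_option linter.dupNamespace false
set_option autoImplicit false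

namespace Summit.ValiantsHypothesis.ValiantsHypothesis.Theorems.RigidityForcesSymmetryRankRigidMinimalRepr

namespace LaplaceFiveSeparatedCapture

open Finset LaplaceFiveSectorSplit

/-- ★★ **K1 ON `K₃ ⊔ K₂` FOR «TWO TRIANGLE CUTS WITH ≤ 1 DIRECTION, THE THIRD WITH ≤ 3» — UNCONDITIONAL.**  A side-symmetric split
decomposition of `P₅` on `{01, 02, 12, 34}` whose short spans on `{0,1}` and `{0,2}` have dimension `≤ 1` and whose short span on
`{1,2}` has dimension `≤ 3` has Laplace weight `≥ 5! = 120`. [folklore] -/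
theorem sideSym_K32canon_two_lines_three {N : ℕ} (T : Finset (Fin N)) (S : Fin N → Finset (Fin 5))
    (u w : Fin N → (Fin 5 → Fin 5) → ℂ) (hdec : IsSplitDecomposition T S u w) (hsym : SideSymmetric T S u w)
    (hC : ∀ t ∈ T, S t = ({0, 1} : Finset (Fin 5)) ∨ S t = ({0, 2} : Finset (Fin 5)) ∨
      S t = ({1, 2} : Finset (Fin 5)) ∨ S t = ({3, 4} : Finset (Fin 5)))
    (h01 : Module.finrank ℂ (shortSpan T S u 0 1) ≤ 1) (h02 : Module.finrank ℂ (shortSpan T S u 0 2) ≤ 1)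
    (h12 : Module.finrank ℂ (shortSpan T S u 1 2) ≤ 3) :
    Nat.factorial 5 ≤ laplaceWeight T S := by
  refine sideSym_K32canon_of_captureAt T S u w hdec hsym hC fun hs01 hs02 hs12 W hWs hWd hWc => ?_
  rcases eq_bot_or_line_of_finrank_le_one _ h01 with hb1 | ⟨u₁, hn₁, -, he₁⟩
  · exact captureIneqSym_of_one_bot _ _ _ W hs01 hs02 hs12 (Or.inl hb1) hWs hWd hWc
  rcases eq_bot_or_line_of_finrank_le_one _ h02 with hb2 | ⟨u₂, hn₂, -, he₂⟩
  · exact captureIneqSym_of_one_bot _ _ _ W hs01 hs02 hs12 (Or.inr (Or.inl hb2)) hWs hWd hWc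
  have hu₁ : ∀ p q, u₁ p q = u₁ q p := fun p q => hs01 u₁ (by rw [he₁]; exact Submodule.mem_span_singleton_self u₁) p q
  have hu₂ : ∀ p q, u₂ p q = u₂ q p := fun p q => hs02 u₂ (by rw [he₂]; exact Submodule.mem_span_singleton_self u₂) p q
  have h := captureIneqSym_of_two_lines_le_three u₁ u₂ hu₁ hu₂ hn₁ hn₂ (shortSpan T S u 1 2) W hs12 h12 hWs hWd
    (fun μ hμ => by rw [← he₁, ← he₂]; exact hWc μ hμ)
  rw [← he₁, ← he₂] at h
  exact h

/-- ★ **The same with the wide cut at `{0,1}`**: dimensions `≤ 3, ≤ 1, ≤ 1` on `{0,1}, {0,2}, {1,2}` (✓ `contractZ_mem_L3_swap13`). [folklore] -/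
theorem sideSym_K32canon_two_lines_three_wide01 {N : ℕ} (T : Finset (Fin N)) (S : Fin N → Finset (Fin 5))
    (u w : Fin N → (Fin 5 → Fin 5) → ℂ) (hdec : IsSplitDecomposition T S u w) (hsym : SideSymmetric T S u w)
    (hC : ∀ t ∈ T, S t = ({0, 1} : Finset (Fin 5)) ∨ S t = ({0, 2} : Finset (Fin 5)) ∨
      S t = ({1, 2} : Finset (Fin 5)) ∨ S t = ({3, 4} : Finset (Fin 5)))
    (h01 : Module.finrank ℂ (shortSpan T S u 0 1) ≤ 3) (h02 : Module.finrank ℂ (shortSpan T S u 0 2) ≤ 1)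
    (h12 : Module.finrank ℂ (shortSpan T S u 1 2) ≤ 1) :
    Nat.factorial 5 ≤ laplaceWeight T S := by
  refine sideSym_K32canon_of_captureAt T S u w hdec hsym hC fun hs01 hs02 hs12 W hWs hWd hWc => ?_
  have hWc' : ∀ μ ∈ W, contractZ μ ∈ L3 (shortSpan T S u 1 2) (shortSpan T S u 0 2) (shortSpan T S u 0 1) :=
    fun μ hμ => contractZ_mem_L3_swap13 _ _ _ hs01 hs02 hs12 μ (hWc μ hμ)
  rcases eq_bot_or_line_of_finrank_le_one _ h12 with hb1 | ⟨u₁, hn₁, -, he₁⟩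
  · have h := captureIneqSym_of_one_bot _ _ _ W hs12 hs02 hs01 (Or.inl hb1) hWs hWd hWc'
    omega
  rcases eq_bot_or_line_of_finrank_le_one _ h02 with hb2 | ⟨u₂, hn₂, -, he₂⟩
  · have h := captureIneqSym_of_one_bot _ _ _ W hs12 hs02 hs01 (Or.inr (Or.inl hb2)) hWs hWd hWc'
    omega
  have hu₁ : ∀ p q, u₁ p q = u₁ q p := fun p q => hs12 u₁ (by rw [he₁]; exact Submodule.mem_span_singleton_self u₁) p q
  have hu₂ : ∀ p q, u₂ p q = u₂ q p := fun p q => hs02 u₂ (by rw [he₂]; exact Submodule.mem_span_singleton_self u₂) p q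
  have h := captureIneqSym_of_two_lines_le_three u₁ u₂ hu₁ hu₂ hn₁ hn₂ (shortSpan T S u 0 1) W hs01 h01 hWs hWd
    (fun μ hμ => by rw [← he₁, ← he₂]; exact hWc' μ hμ)
  rw [← he₁, ← he₂] at h
  omega

/-- ★ **The same with the wide cut at `{0,2}`**: dimensions `≤ 1, ≤ 3, ≤ 1` (✓ `contractZ_mem_L3_swap23`). [folklore] -/
theorem sideSym_K32canon_two_lines_three_wide02 {N : ℕ} (T : Finset (Fin N)) (S : Fin N → Finset (Fin 5))
    (u w : Fin N → (Fin 5 → Fin 5) → ℂ) (hdec : IsSplitDecomposition T S u w) (hsym : SideSymmetric T S u w)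
    (hC : ∀ t ∈ T, S t = ({0, 1} : Finset (Fin 5)) ∨ S t = ({0, 2} : Finset (Fin 5)) ∨
      S t = ({1, 2} : Finset (Fin 5)) ∨ S t = ({3, 4} : Finset (Fin 5)))
    (h01 : Module.finrank ℂ (shortSpan T S u 0 1) ≤ 1) (h02 : Module.finrank ℂ (shortSpan T S u 0 2) ≤ 3)
    (h12 : Module.finrank ℂ (shortSpan T S u 1 2) ≤ 1) :
    Nat.factorial 5 ≤ laplaceWeight T S := by
  refine sideSym_K32canon_of_captureAt T S u w hdec hsym hC fun hs01 hs02 hs12 W hWs hWd hWc => ?_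
  have hWc' : ∀ μ ∈ W, contractZ μ ∈ L3 (shortSpan T S u 0 1) (shortSpan T S u 1 2) (shortSpan T S u 0 2) :=
    fun μ hμ => contractZ_mem_L3_swap23 _ _ _ hs01 μ (hWc μ hμ)
  rcases eq_bot_or_line_of_finrank_le_one _ h01 with hb1 | ⟨u₁, hn₁, -, he₁⟩
  · have h := captureIneqSym_of_one_bot _ _ _ W hs01 hs12 hs02 (Or.inl hb1) hWs hWd hWc'
    omega
  rcases eq_bot_or_line_of_finrank_le_one _ h12 with hb2 | ⟨u₂, hn₂, -, he₂⟩
  · have h := captureIneqSym_of_one_bot _ _ _ W hs01 hs12 hs02 (Or.inr (Or.inl hb2)) hWs hWd hWc'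
    omega
  have hu₁ : ∀ p q, u₁ p q = u₁ q p := fun p q => hs01 u₁ (by rw [he₁]; exact Submodule.mem_span_singleton_self u₁) p q
  have hu₂ : ∀ p q, u₂ p q = u₂ q p := fun p q => hs12 u₂ (by rw [he₂]; exact Submodule.mem_span_singleton_self u₂) p q
  have h := captureIneqSym_of_two_lines_le_three u₁ u₂ hu₁ hu₂ hn₁ hn₂ (shortSpan T S u 0 2) W hs02 h02 hWs hWd
    (fun μ hμ => by rw [← he₁, ← he₂]; exact hWc' μ hμ)
  rw [← he₁, ← he₂] at h
  omega

/-- ★★ **K1 ON `K₃ ⊔ K₂` FOR A PROLONGATION-FREE JOINT SHORT SPAN** — if no nonzero fully symmetric 3-tensor has all its slices in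
`shortSpan 01 ⊔ shortSpan 02 ⊔ shortSpan 12`, a side-symmetric split decomposition of `P₅` on `{01, 02, 12, 34}` has Laplace weight
`≥ 5! = 120` (short spans of ANY dimensions; ✓ `captureIneqSym_of_prolong_eq_bot`). [folklore] -/
theorem sideSym_K32canon_of_prolong_eq_bot {N : ℕ} (T : Finset (Fin N)) (S : Fin N → Finset (Fin 5))
    (u w : Fin N → (Fin 5 → Fin 5) → ℂ) (hdec : IsSplitDecomposition T S u w) (hsym : SideSymmetric T S u w)
    (hC : ∀ t ∈ T, S t = ({0, 1} : Finset (Fin 5)) ∨ S t = ({0, 2} : Finset (Fin 5)) ∨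
      S t = ({1, 2} : Finset (Fin 5)) ∨ S t = ({3, 4} : Finset (Fin 5)))
    (hP : prolong (shortSpan T S u 0 1 ⊔ shortSpan T S u 0 2 ⊔ shortSpan T S u 1 2) = ⊥) :
    Nat.factorial 5 ≤ laplaceWeight T S := by
  refine sideSym_K32canon_of_captureAt T S u w hdec hsym hC fun hs01 hs02 hs12 W hWs hWd hWc => ?_
  exact captureIneqSym_of_prolong_eq_bot _ _ _ W hs01 hs02 hs12 hP hWs hWd hWc

end LaplaceFiveSeparatedCapture

end Summit.ValiantsHypothesis.ValiantsHypothesis.Theorems.RigidityForcesSymmetryRankRigidMinimalRepr
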